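import Summits.MatrixMultiplication.MatrixMultiplication.Theorems.OutsiderSandwichLevelLaw
import HarnessLib

/-!
# No level of the exchange table is asymptotically free: `a(N, m) ≥ m·(1 + 4^{-N})`

Route `OutsiderSandwich` (decomposition cell `decomp-mm`, lens 4 «minimal counterexample /
extremal reduction», gen 28, addendum), support for the aside leaf `BlockOneIsMM`
(stmt-MatrixMultiplication-27147).

**Theorem** (`rate_law`).  For every `N ≥ 1`: if `⟨B⟩ ⊠ C₁^{⊠N} ⊵ ⟨m⟩ ⊠ ⟨2,2,2⟩^{⊠N}`
(`Amortised N B m`) then `(4^N + 1)·m ≤ 4^N·B`.  Hence the level-`N` amortised rate satisfies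
`ρ_N = inf_m a(N,m)/m ≥ 1 + 4^{-N} > 1` (`rate_amortisedNumber`): no level of the exchange table is
asymptotically free.  At level two, `17m ≤ 16·a(2,m)` (`level_two_rate`); the first entries this
pushes above the `m + 1` floor of `OutsiderSandwichNoTightExchange.not_tight` are
`a(2,17) ≥ 19` and `a(2,32) ≥ 34` (`amortisedNumber_two_seventeen`, `amortisedNumber_two_32`).

Proof.  This is the first unconditional instance of the level-`N` law
`OutsiderSandwichLevelLaw.level_law`, fed with the **cheap core bound**
(`pairRank_add_two_le`): a space `L` of pairs of `n × n` matrices with `V·Y = 0` on `L` has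
`dim π₁L + dim π₂L ≤ 2n² − 2` (`n ≥ 2`).  Indeed if `π₁L` is everything then some `(1, b) ∈ L`,
so `b = 0`, and for every `(p, q) ∈ L` the pair `(1 + p, q)` lies in `L`, giving
`q = (1 + p)q − pq = 0`: `π₂L = 0`; symmetrically for `π₂L`; otherwise both projections are proper
subspaces.  The level law then reads `4m·4^N ≤ m(2·4^N − 2) + 2B·4^N`.  (The full core bound
`dim π₁L + dim π₂L ≤ n²` — Flanders–Meshulam — would give `3m ≤ 2B` at every level; it is not
formalised.)

## References
* D. Coppersmith, S. Winograd, *Matrix multiplication via arithmetic progressions*,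
  J. Symbolic Comput. 9 (1990) 251–280, §7 (the coupled block `C₁`). [CoppersmithWinograd1990]
* P. Bürgisser, M. Clausen, M. A. Shokrollahi, *Algebraic Complexity Theory*, Springer (1997),
  §14.4, §17.1 (restriction, conciseness, substitution). [BurgisserClausenShokrollahi1997]
-/

noncomputable section
open scoped BigOperators Matrix
set_option linter.dupNamespace false
set_option autoImplicit false

namespace Summit.MatrixMultiplication.MatrixMultiplication.Theorems.OutsiderSandwichLevelRate

open Literature.Computability.AlgebraicComplexity
open Summit.MatrixMultiplication.MatrixMultiplication.Theorems.OutsiderSandwichNoTightExchange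
open Summit.MatrixMultiplication.MatrixMultiplication.Theorems.OutsiderSandwichCoupling (coupling₁)
open Summit.MatrixMultiplication.MatrixMultiplication.Theorems.OutsiderSandwichAmortisedTable
open Summit.MatrixMultiplication.MatrixMultiplication.Theorems.OutsiderSandwichLevelLaw

/-! ## 1. The cheap core bound -/

section Core

variable {ρ : Type} [Fintype ρ] [DecidableEq ρ]

/-- If `π₁L` is everything then `π₂L = 0`. [cite: BurgisserClausenShokrollahi1997, §17.1] -/
theorem snd_eq_bot_of_fst_eq_top (L : Submodule ℂ (Matrix ρ ρ ℂ × Matrix ρ ρ ℂ))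
    (hL : ∀ x ∈ L, x.1 * x.2 = 0)
    (htop : L.map (LinearMap.fst ℂ (Matrix ρ ρ ℂ) (Matrix ρ ρ ℂ)) = ⊤) :
    L.map (LinearMap.snd ℂ (Matrix ρ ρ ℂ) (Matrix ρ ρ ℂ)) = ⊥ := by
  obtain ⟨x, hx, hx1⟩ : ∃ x ∈ L, x.1 = 1 := by
    have h1 : (1 : Matrix ρ ρ ℂ) ∈ L.map (LinearMap.fst ℂ (Matrix ρ ρ ℂ) (Matrix ρ ρ ℂ)) :=
      htop ▸ Submodule.mem_top
    obtain ⟨x, hx, e⟩ := Submodule.mem_map.1 h1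
    exact ⟨x, hx, e⟩
  have hx2 : x.2 = 0 := by
    have e := hL x hx
    rwa [hx1, one_mul] at e
  rw [Submodule.eq_bot_iff]
  intro y hy
  obtain ⟨z, hz, rfl⟩ := Submodule.mem_map.1 hy
  have e := hL (x + z) (L.add_mem hx hz)
  rw [Prod.fst_add, Prod.snd_add, hx1, hx2, zero_add, add_mul, one_mul, hL z hz, add_zero] at e
  exact e

/-- If `π₂L` is everything then `π₁L = 0`. [cite: BurgisserClausenShokrollahi1997, §17.1] -/
theorem fst_eq_bot_of_snd_eq_top (L : Submodule ℂ (Matrix ρ ρ ℂ × Matrix ρ ρ ℂ))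
    (hL : ∀ x ∈ L, x.1 * x.2 = 0)
    (htop : L.map (LinearMap.snd ℂ (Matrix ρ ρ ℂ) (Matrix ρ ρ ℂ)) = ⊤) :
    L.map (LinearMap.fst ℂ (Matrix ρ ρ ℂ) (Matrix ρ ρ ℂ)) = ⊥ := by
  obtain ⟨x, hx, hx2⟩ : ∃ x ∈ L, x.2 = 1 := by
    have h1 : (1 : Matrix ρ ρ ℂ) ∈ L.map (LinearMap.snd ℂ (Matrix ρ ρ ℂ) (Matrix ρ ρ ℂ)) :=
      htop ▸ Submodule.mem_top
    obtain ⟨x, hx, e⟩ := Submodule.mem_map.1 h1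
    exact ⟨x, hx, e⟩
  have hx1 : x.1 = 0 := by
    have e := hL x hx
    rwa [hx2, mul_one] at e
  rw [Submodule.eq_bot_iff]
  intro y hy
  obtain ⟨z, hz, rfl⟩ := Submodule.mem_map.1 hy
  have e := hL (x + z) (L.add_mem hx hz)
  rw [Prod.fst_add, Prod.snd_add, hx1, hx2, zero_add, mul_add, mul_one, hL z hz, add_zero] at e
  exact e

/-- **Cheap core bound.**  For `|ρ| ≥ 2`, a space `L` of pairs of `ρ × ρ` matrices with
`V · Y = 0` on `L` has `dim π₁L + dim π₂L ≤ 2|ρ|² − 2`.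
[cite: BurgisserClausenShokrollahi1997, §17.1] -/
theorem pairRank_add_two_le (hρ : 2 ≤ Fintype.card ρ)
    (L : Submodule ℂ (Matrix ρ ρ ℂ × Matrix ρ ρ ℂ)) (hL : ∀ x ∈ L, x.1 * x.2 = 0) :
    pairRank ρ L + 2 ≤ 2 * Fintype.card ρ ^ 2 := by
  have hM : Module.finrank ℂ (Matrix ρ ρ ℂ) = Fintype.card ρ ^ 2 := by
    rw [Module.finrank_matrix, Module.finrank_self, mul_one, sq]
  have hsq : 4 ≤ Fintype.card ρ ^ 2 := by
    have e : 2 ^ 2 ≤ Fintype.card ρ ^ 2 := Nat.pow_le_pow_left hρ 2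
    simpa using e
  unfold pairRank
  by_cases hP : L.map (LinearMap.fst ℂ (Matrix ρ ρ ℂ) (Matrix ρ ρ ℂ)) = ⊤
  · rw [snd_eq_bot_of_fst_eq_top L hL hP, finrank_bot, hP, finrank_top, hM]
    omega
  · by_cases hQ : L.map (LinearMap.snd ℂ (Matrix ρ ρ ℂ) (Matrix ρ ρ ℂ)) = ⊤
    · rw [fst_eq_bot_of_snd_eq_top L hL hQ, finrank_bot, hQ, finrank_top, hM]
      omega
    · have h1 := Submodule.finrank_lt hP
      have h2 := Submodule.finrank_lt hQ
      rw [hM] at h1 h2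
      omega

end Core

/-- The cheap core bound at format `2^N`: `pairRank ≤ 2·4^N − 2`.
[cite: BurgisserClausenShokrollahi1997, §17.1] -/
theorem pairRank_le_cheap {N : ℕ} (hN : 1 ≤ N)
    (L : Submodule ℂ (Matrix (Fin N → Fin 2) (Fin N → Fin 2) ℂ ×
      Matrix (Fin N → Fin 2) (Fin N → Fin 2) ℂ))
    (hL : ∀ x ∈ L, x.1 * x.2 = 0) : pairRank (Fin N → Fin 2) L ≤ 2 * 4 ^ N - 2 := by
  have hcard : Fintype.card (Fin N → Fin 2) = 2 ^ N := by
    simp only [Fintype.card_fun, Fintype.card_fin]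
  have hρ : 2 ≤ Fintype.card (Fin N → Fin 2) := by
    rw [hcard]
    exact le_trans (by norm_num) (Nat.pow_le_pow_right (by norm_num) hN)
  have h := pairRank_add_two_le hρ L hL
  have h4 : Fintype.card (Fin N → Fin 2) ^ 2 = 4 ^ N := by
    rw [hcard, ← pow_mul, mul_comm, pow_mul]; norm_num
  rw [h4] at h
  omega

/-! ## 2. The rate law -/

/-- **Rate law**: `⟨B⟩ ⊠ C₁^{⊠N} ⊵ ⟨m⟩ ⊠ ⟨2,2,2⟩^{⊠N}` (`N ≥ 1`) forces `(4^N + 1)·m ≤ 4^N·B`.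
[cite: CoppersmithWinograd1990, §7] -/
theorem rate_law {N B m : ℕ} (hN : 1 ≤ N) (h : Amortised N B m) :
    (4 ^ N + 1) * m ≤ 4 ^ N * B := by
  have key := level_law hN (Equiv.refl _) (fun L hL => pairRank_le_cheap hN L hL) h
  have hK : 1 ≤ 4 ^ N := Nat.one_le_pow _ _ (by norm_num)
  have e : m * (2 * 4 ^ N - 2) + m * 2 = 2 * (m * 4 ^ N) := by
    rw [← Nat.mul_add, Nat.sub_add_cancel (by omega)]; ring
  have key' : 4 * (m * 4 ^ N) ≤ m * (2 * 4 ^ N - 2) + 2 * (B * 4 ^ N) := by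
    simpa only [mul_assoc] using key
  rw [add_mul, one_mul, mul_comm (4 ^ N) m, mul_comm (4 ^ N) B]
  omega

/-- `(4^N + 1)·m ≤ 4^N·a(N, m)`: the level-`N` rate is at least `1 + 4^{-N}`.
[cite: CoppersmithWinograd1990, §7] -/
theorem rate_amortisedNumber {N : ℕ} (hN : 1 ≤ N) (m : ℕ) :
    (4 ^ N + 1) * m ≤ 4 ^ N * amortisedNumber N m :=
  rate_law hN (amortised_amortisedNumber N m)

/-- Level two: `17m ≤ 16·a(2, m)`. [cite: CoppersmithWinograd1990, §7] -/
theorem level_two_rate (m : ℕ) : 17 * m ≤ 16 * amortisedNumber 2 m := by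
  have h := rate_amortisedNumber (by norm_num : 1 ≤ 2) m
  norm_num at h
  exact h

/-- **`a(2,17) ≥ 19`**: `⟨18⟩ ⊠ C₁^{⊠2} ⋭ ⟨17⟩ ⊠ ⟨2,2,2⟩^{⊠2}` — the first level-two entry above
the `m + 1` floor. [cite: CoppersmithWinograd1990, §7] -/
theorem amortisedNumber_two_seventeen : 19 ≤ amortisedNumber 2 17 := by
  have h := level_two_rate 17
  omega

/-- **`a(2,32) ≥ 34`.** [cite: CoppersmithWinograd1990, §7] -/
theorem amortisedNumber_two_32 : 34 ≤ amortisedNumber 2 32 := by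
  have h := level_two_rate 32
  omega

/-- `⟨18⟩ ⊠ C₁^{⊠2} ⋭ ⟨17⟩ ⊠ ⟨2,2,2⟩^{⊠2}`. [cite: CoppersmithWinograd1990, §7] -/
theorem not_amortised_two_18_17 : ¬ Amortised 2 18 17 := fun h => by
  have e := rate_law (by norm_num : 1 ≤ 2) h
  norm_num at e

end Summit.MatrixMultiplication.MatrixMultiplication.Theorems.OutsiderSandwichLevelRate
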